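import Summits.QuantumFields.YangMills.Theorems.BalabanUVNodesN15KingModelPotentialComplexLimitLetters

/-!
# N15 (NE2) King-model rung, PART 37 — THE COUPLING EXPANSION CONVERGES, UNIFORMLY IN THE CUTOFF, WITH EXPONENTIALLY LOCAL COEFFICIENTS
# AND REMAINDERS; the coefficients of the two-spacing difference carry NE2's η-rate; the continuum limit has the same expansion

Eleventh generation (g11) of the seat `pub-ymgap-dag-n15-d`, part 37 (on 33 `…PotentialComplexLimitLetters` and 28c `…VitaliDisc`).  The dressed covariance
`C^{(k)}_{z·v} = (Δ^{(k)}_{z·v} + aL⁻²Q*Q)⁻¹` at coupling `z` is the free block-spin covariance (`z = 0`) perturbed by the φ²-type insertion `z·v`; its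
TAYLOR SERIES at `z = 0` is the perturbation series in the coupling, its `n`-th coefficient `c_n^{(k)}(x,y) = ∂ⁿ_z C^{(k)}_{z·v}(x,y)|₀∕n!` (28c's `tcoeff`)
the `n`-th order kernel.  Holomorphy on the coupling disc (28b) makes the series CONVERGE there (`hasSum_tcoeff`), and 32∕33's DECAYING bounds on the disc
make Cauchy's estimates decay: so perturbation theory in the coupling converges uniformly in the cutoff `k`, with exponentially local coefficients
and exponentially local, geometrically small remainders — and the same for the continuum limit `C^{(∞)}_z` (33):

* §1 (any unit torus, 9c's window) ★★ `kingCovPotC_series` — on `‖z‖ < ρ < R₂ := (r∕(1+r))·min(r_K∕w₀, 1)`: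
  (i) `Σ_n c_n^{(k)}(x,y)·zⁿ = C^{(k)}_{z·v}(x,y)`; (ii) `‖c_n^{(k)}(x,y)‖ ≤ (4∕γ₀)e^{−(1−λ(r))κ′|x−y|}∕ρⁿ`; (iii) the order-`N` remainder is
  `≤ (4∕γ₀)e^{−(1−λ(r))κ′|x−y|}·(‖z‖∕ρ)^N∕(1 − ‖z‖∕ρ)` — all uniform in `k ≥ 1`, the volume, the potential;
* §2 (King-admissible tori, 10e's window) ★★★ `kingCov_series_package` — the same for `C^{(k)}_{z·v}` (k ≥ 1) AND for the continuum limit `C^{(∞)}_z`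
  (its perturbation series converges to it with local coefficients and remainders), and ★★ the coefficients ∕ remainders of the TWO-SPACING DIFFERENCE
  `C^{(k+1)}_{z·v} − C^{(k)}_{z·v}` are `≤ C^{1−λ}M^{λ}ϑ^k·e^{−(1−λ)(κ₂∕2)|x−y|}∕ρⁿ` resp. `·(‖z‖∕ρ)^N∕(1−‖z‖∕ρ)` — every order of perturbation theory, and
  the error of every truncation, has NE2's η-rate with decay.

References (method): Taylor series ∕ Cauchy estimates on a disc [folklore] (28c over Mathlib `Complex.hasSum_taylorSeries_on_ball`,
`Complex.norm_iteratedDeriv_le_of_forall_mem_sphere_norm_le`); two-constants theorem via 32∕33 (tree's `TwoConstantsDisc` ∕ `B13RealSliceEntryLetters`, BY NAME);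
template [B9] Thm 3.4 p.400, (3.64)–(3.65) p.402; King (4.34), Lemma 4.5 (4.38) p.674, §4 pp.675–676.

HONEST SCOPE.  King's A = 0 SCALAR model; expansion in ONE complex coupling of a real potential tower (a φ²-type insertion), NOT a loop ∕ cluster
expansion and NOT an expansion in a gauge coupling; nothing about Bałaban's `U′U` ∕ `C^{(k)}(Λ;U)`; NOT a node discharge; count-neutral.  No `sorry`.
-/

noncomputable section

open scoped BigOperators Matrix
open Filter Topology Metric Finset Complex

namespace Summit.QuantumFields.YangMills.BalabanUVNodes.N15.KingModel

open Literature.MathematicalPhysics.QuantumFieldTheory.Balaban1983to89 hiding blockOf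
open Literature.MathematicalPhysics.QuantumFieldTheory.Balaban1983to89.B5Prop11Plancherel (Tor fine)
open Literature.MathematicalPhysics.QuantumFieldTheory.Balaban1983to89.B13RealSliceEntryLetters (lam lam_nonneg lam_lt_one)
open Literature.MathematicalPhysics.QuantumFieldTheory.King1986.Torus (gam0L gam0L_pos tdistT tdistT_isPseudoDist kapCT kapCT_pos_le)
open Summit.QuantumFields.YangMills.BalabanUVNodes.N15KingModelRung.Curved (underPtN)

variable {d : ℕ}

/-- **The three conclusions of 28c's Taylor lemmas for a function holomorphic on `ball 0 R` and bounded by `K` there**, at `‖z‖ < ρ < R`: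
the series converges to the function, `‖c_n‖ ≤ K∕ρⁿ`, and the order-`N` remainder is `≤ K·(‖z‖∕ρ)^N∕(1−‖z‖∕ρ)`. [folklore] -/
theorem series_facts {g : ℂ → ℂ} {R K ρ : ℝ} (hg : DifferentiableOn ℂ g (ball (0 : ℂ) R)) (hK : ∀ z ∈ ball (0 : ℂ) R, ‖g z‖ ≤ K)
    (hρ : 0 < ρ) (hρR : ρ < R) {z : ℂ} (hz : ‖z‖ < ρ) :
    HasSum (fun n => tcoeff g n * z ^ n) (g z) ∧ (∀ n, ‖tcoeff g n‖ ≤ K / ρ ^ n) ∧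
      ∀ N, ‖g z - ∑ m ∈ range N, tcoeff g m * z ^ m‖ ≤ K * (‖z‖ / ρ) ^ N * (1 - ‖z‖ / ρ)⁻¹ :=
  ⟨hasSum_tcoeff hg (by rw [mem_ball_zero_iff]; linarith), fun n => norm_tcoeff_le hg hK hρ hρR n,
    fun N => norm_sub_taylor_partial_le hg hK hρ hρR hz N⟩

/-! ## §1 The coupling expansion of the dressed covariance: convergent, local coefficients, local remainders (any unit torus) -/

section AnyTorus

variable {a m2 : ℝ} {L : ℕ} [NeZero L] {M : Fin (d + 1) → ℕ} [∀ μ, NeZero (M μ)]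

/-- ★★ **PERTURBATION THEORY IN THE COUPLING CONVERGES, UNIFORMLY IN THE CUTOFF, WITH LOCAL COEFFICIENTS AND REMAINDERS.**  For `L ≥ 2`,
`a, m² > 0`, `k ≥ 1`, a potential tower with `sup|v_N| ≤ w₀`, `0 < w₀ ≤ w̄`, 9c's smallness, every `0 < r < 1`, every `0 < ρ < R₂ := (r∕(1+r))·min(r_K∕w₀, 1)`
and every coupling `‖z‖ < ρ`, writing `c_n := tcoeff (ζ ↦ C^{(k)}_{ζ·v}(x,y)) n` (the `n`-th order kernel):
(i) `Σ_n c_n·zⁿ = C^{(k)}_{z·v}(x,y)`; (ii) `‖c_n‖ ≤ (4∕γ₀)·e^{−(1−λ(r))κ′|x−y|_T}∕ρⁿ` for all `n`;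
(iii) `‖C^{(k)}_{z·v}(x,y) − Σ_{m<N} c_m·z^m‖ ≤ (4∕γ₀)·e^{−(1−λ(r))κ′|x−y|_T}·(‖z‖∕ρ)^N·(1 − ‖z‖∕ρ)⁻¹` for all `N`
(28c's Taylor lemmas on 32's holomorphy `differentiableOn_kingCovPotC_ball` and decaying bound `kingCovPotC_apply_decay`).
[cite: Balaban1985BackgroundPropagators, Thm 3.4 p.400, (3.64)–(3.65) p.402 (template); King1986, (4.34) p.674 (A = 0); Ransford1995, Thm. 4.3.7] -/
theorem kingCovPotC_series (ha : 0 < a) (hm : 0 < m2) (hL : 2 ≤ L) {k : ℕ} (hk : 1 ≤ k)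
    {v : ∀ N : ℕ, Tor (fine N (fine L M)) → ℝ} {w₀ : ℝ} (hw₀ : 0 < w₀) (hwb : w₀ ≤ wbarK (d + 1) a L) (hv : ∀ N x, |v N x| ≤ w₀)
    (hsmall : a ^ 2 * ctCK (d + 1) a L ^ 2 * kwSum (d + 1) a L * w₀ ≤ kingCbar (d + 1) a L)
    {r : ℝ} (hr0 : 0 < r) (hr1 : r < 1) {ρ : ℝ} (hρ : 0 < ρ) (hρR : ρ < r / (1 + r) * min (cplxWindow d a m2 L / w₀) 1)
    {z : ℂ} (hz : ‖z‖ < ρ) (x y : Tor (fine L M)) :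
    let g : ℂ → ℂ := fun ζ => kingCovPotC d a m2 L M k ζ (v (L ^ k)) x y
    let K : ℝ := 4 / gam0L (d + 1) a L * Real.exp (-((1 - lam r) * kapCT (d + 1) a L * tdistT (fine L M) x y))
    HasSum (fun n => tcoeff g n * z ^ n) (g z) ∧ (∀ n, ‖tcoeff g n‖ ≤ K / ρ ^ n) ∧
      ∀ N, ‖g z - ∑ m ∈ range N, tcoeff g m * z ^ m‖ ≤ K * (‖z‖ / ρ) ^ N * (1 - ‖z‖ / ρ)⁻¹ := by
  intro g K
  have hwin := cplxWindow_pos (d := d) (a := a) (m2 := m2) (L := L) ha hm hL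
  have hrad : r / (1 + r) * min (cplxWindow d a m2 L / w₀) 1 ≤ min (cplxWindow d a m2 L / w₀) 1 := by
    have h1 : r / (1 + r) ≤ 1 := (div_le_one (by linarith)).2 (by linarith)
    have h2 : 0 ≤ min (cplxWindow d a m2 L / w₀) 1 := le_min (div_pos hwin hw₀).le zero_le_one
    calc r / (1 + r) * min (cplxWindow d a m2 L / w₀) 1 ≤ 1 * min (cplxWindow d a m2 L / w₀) 1 := mul_le_mul_of_nonneg_right h1 h2
      _ = _ := one_mul _
  have hg : DifferentiableOn ℂ g (ball (0 : ℂ) (r / (1 + r) * min (cplxWindow d a m2 L / w₀) 1)) :=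
    (differentiableOn_kingCovPotC_ball (d := d) ha hm hL hk hw₀ (hv _) x y).mono (ball_subset_ball hrad)
  have hK : ∀ ζ ∈ ball (0 : ℂ) (r / (1 + r) * min (cplxWindow d a m2 L / w₀) 1), ‖g ζ‖ ≤ K := fun ζ hζ =>
    kingCovPotC_apply_decay (M := M) ha hm hL hk hw₀ hwb hv hsmall hr0 hr1 (mem_ball_zero_iff.1 hζ) x y
  exact series_facts hg hK hρ hρR hz

end AnyTorus

/-! ## §2 King-admissible tori: the levels, the continuum limit and the two-spacing difference -/

section KingU

variable (L : ℕ) [NeZero L]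

/-- ★★★ **THE COUPLING EXPANSIONS OF THE LEVELS, OF THE CONTINUUM LIMIT AND OF THE TWO-SPACING DIFFERENCE — ONE PACKAGE.**  For odd `L ≥ 3`,
`a, m² > 0` there are `κ₁, κ₂, w₁, C > 0` such that for every volume exponent, every potential tower of 10e's window (`sup|v_N| ≤ w₀ ≤ w₁`, `w₀ > 0`,
coherence defect `≤ ν₀s^k`), every `0 < r < 1`, every `0 < ρ < R₂ := (r∕(1+r))·min(r_K∕w₀, 1)`, every coupling `‖z‖ < ρ` and all sites, writing
`K₁ := (4∕γ₀)e^{−(1−λ(r))κ₁|x−y|_T}`, `K₂(k) := C^{1−λ}M^{λ}ϑ^k·e^{−(1−λ)(κ₂∕2)|x−y|_T}` (`ϑ = θ^{1−λ(r)}`, `θ = L^{−1∕4}`, `M = max(C, 4∕γ₀)`),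
`q := ‖z‖∕ρ`:
(a) for every `k ≥ 1` the series of `ζ ↦ C^{(k)}_{ζ·v}(x,y)` converges to it at `z`, its coefficients are `≤ K₁∕ρⁿ`, its remainders `≤ K₁·q^N∕(1−q)`;
(b) the same three facts for the CONTINUUM LIMIT `ζ ↦ C^{(∞)}_ζ(x,y)`;
(c) for every `k ≥ 1` the series of the TWO-SPACING DIFFERENCE `ζ ↦ C^{(k+1)}_{ζ·v}(x,y) − C^{(k)}_{ζ·v}(x,y)` converges to it, with coefficients
`≤ K₂(k)∕ρⁿ` and remainders `≤ K₂(k)·q^N∕(1−q)` — EVERY ORDER OF PERTURBATION THEORY, AND EVERY TRUNCATION ERROR, HAS NE2's η-RATE WITH DECAY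
(28c's Taylor lemmas on 33's `kingModel_complexCoupling_package` (a)(c)(d)).
[cite: King1986, Lemma 4.5 (4.38) p.674, §4 pp.675–676 (A = 0 template); Balaban1985BackgroundPropagators, Thm 3.4 p.400; Ransford1995, Thm. 4.3.7] -/
theorem kingCov_series_package (hLodd : Odd L) (hL : 2 ≤ L) {a m2 : ℝ} (ha : 0 < a) (hm : 0 < m2) :
    ∃ κ₁ κ₂ w₁ C : ℝ, 0 < κ₁ ∧ 0 < κ₂ ∧ 0 < w₁ ∧ 0 < C ∧
      ∀ (e : ℕ) (v : ∀ N : ℕ, Tor (fine N (kingU d L e)) → ℝ) (w₀ ν₀ s : ℝ),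
      0 ≤ ν₀ → ν₀ ≤ w₁ → 0 ≤ s → s ≤ (L : ℝ) ^ (-(1 / 2 : ℝ)) →
      0 < w₀ → (∀ (N : ℕ) (x : Tor (fine N (kingU d L e))), |v N x| ≤ w₀) → w₀ ≤ w₁ →
      (∀ (k : ℕ), 1 ≤ k → ∀ x' : Tor (fine (L ^ 1 * L ^ k) (kingU d L e)),
          |v (L ^ 1 * L ^ k) x' - v (L ^ k) (underPtN L k 1 (kingU d L e) x')| ≤ ν₀ * s ^ k) →
      ∀ (r : ℝ), 0 < r → r < 1 → ∀ (ρ : ℝ), 0 < ρ → ρ < r / (1 + r) * min (cplxWindow d a m2 L / w₀) 1 →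
      ∀ z : ℂ, ‖z‖ < ρ → ∀ x y : Tor (kingU d L e),
        let K₁ : ℝ := 4 / gam0L (d + 1) a L * Real.exp (-((1 - lam r) * κ₁ * tdistT (kingU d L e) x y))
        let K₂ : ℕ → ℝ := fun k => C ^ (1 - lam r) * (max C (4 / gam0L (d + 1) a L)) ^ lam r * ((((L : ℝ) ^ (-(1 / 4 : ℝ))) ^ (1 - lam r)) ^ k)
          * Real.exp (-((1 - lam r) * (κ₂ / 2) * tdistT (kingU d L e) x y))
        (∀ k, 1 ≤ k →
          let g : ℂ → ℂ := fun ζ => kingCovPotC d a m2 L (kingM d L e) k ζ (v (L ^ k)) x y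
          HasSum (fun n => tcoeff g n * z ^ n) (g z) ∧ (∀ n, ‖tcoeff g n‖ ≤ K₁ / ρ ^ n) ∧
            ∀ N, ‖g z - ∑ m ∈ range N, tcoeff g m * z ^ m‖ ≤ K₁ * (‖z‖ / ρ) ^ N * (1 - ‖z‖ / ρ)⁻¹) ∧
        (let g : ℂ → ℂ := fun ζ => kingCovLimC a m2 L (kingM d L e) v ζ x y
         HasSum (fun n => tcoeff g n * z ^ n) (g z) ∧ (∀ n, ‖tcoeff g n‖ ≤ K₁ / ρ ^ n) ∧
           ∀ N, ‖g z - ∑ m ∈ range N, tcoeff g m * z ^ m‖ ≤ K₁ * (‖z‖ / ρ) ^ N * (1 - ‖z‖ / ρ)⁻¹) ∧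
        (∀ k, 1 ≤ k →
          let g : ℂ → ℂ := fun ζ => (kingCovPotC d a m2 L (kingM d L e) (k + 1) ζ (v (L ^ (k + 1))) x y
            - kingCovPotC d a m2 L (kingM d L e) k ζ (v (L ^ k)) x y)
          HasSum (fun n => tcoeff g n * z ^ n) (g z) ∧ (∀ n, ‖tcoeff g n‖ ≤ K₂ k / ρ ^ n) ∧
            ∀ N, ‖g z - ∑ m ∈ range N, tcoeff g m * z ^ m‖ ≤ K₂ k * (‖z‖ / ρ) ^ N * (1 - ‖z‖ / ρ)⁻¹) := by
  obtain ⟨κ₁, κ₂, w₁, C, hκ₁, hκ₂, hw₁, hC, H⟩ := kingModel_complexCoupling_package (d := d) L hLodd hL ha hm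
  refine ⟨κ₁, κ₂, w₁, C, hκ₁, hκ₂, hw₁, hC, ?_⟩
  intro e v w₀ ν₀ s hν₀ hν₁ hs0 hs1 hw₀ hv hw₁' hcoh r hr0 hr1 ρ hρ hρR z hz x y K₁ K₂
  set R₂ : ℝ := r / (1 + r) * min (cplxWindow d a m2 L / w₀) 1 with hR₂
  -- the package at the centre gives holomorphy; at every point of the disc it gives the bounds
  have HP := fun ζ (hζ : ‖ζ‖ < R₂) => H e v w₀ ν₀ s hν₀ hν₁ hs0 hs1 hw₀ hv hw₁' hcoh r hr0 hr1 ζ hζ x y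
  have h0 : ‖(0 : ℂ)‖ < R₂ := by rw [norm_zero]; linarith
  obtain ⟨hholk, hhollim, -, -, -, -, -, -, -⟩ := HP 0 h0
  refine ⟨fun k hk => ?_, ?_, fun k hk => ?_⟩
  · refine series_facts (hholk k hk) (fun ζ hζ => ?_) hρ hρR hz
    obtain ⟨-, -, -, -, hc, -, -, -, -⟩ := HP ζ (mem_ball_zero_iff.1 hζ)
    exact hc k hk
  · refine series_facts hhollim (fun ζ hζ => ?_) hρ hρR hz
    obtain ⟨-, -, -, -, -, hclim, -, -, -⟩ := HP ζ (mem_ball_zero_iff.1 hζ)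
    exact hclim
  · refine series_facts ((hholk (k + 1) (Nat.succ_le_succ (Nat.zero_le k))).sub (hholk k hk)) (fun ζ hζ => ?_) hρ hρR hz
    obtain ⟨-, -, -, -, -, -, hd, -, -⟩ := HP ζ (mem_ball_zero_iff.1 hζ)
    exact hd k hk

end KingU

end Summit.QuantumFields.YangMills.BalabanUVNodes.N15.KingModel

end
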